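import Summits.CriticalPhenomena.CardyFormulaZ2.Theorems.CardyMagicRigidityPinchResamplingDefsV3
import HarnessLib

/-!
# Vocabulary v4 of line `pinch-resampling` for crux `NestingRigidity` (stmt-CriticalPhenomena-4835): coarse measurability of neck hook-up probabilities

Route `CardyMagicRigidity` (sub-problem `CriticalPhenomena/CardyFormulaZ2`), crux
`Summit.CriticalPhenomena.CardyFormulaZ2.Theses.CardyMagicRigidity.NestingRigidity ≡ MagicFormulaZ2 → MagicFormulaT → LoopLimitZ2EqT`.
Second definitions ADDENDUM (after `…PinchResamplingDefs` p142657 and `…PinchResamplingDefsV3` p149228) for the lead reshape v4 of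
the checked skeleton `Cruxes/NestingRigidity/Lines/pinch_resampling.lean` (lead seat c5-0, 2026-08-17), written by the wave-2 worker
of the v3 transfer stub (typing note `S10-typing.md`, item evidence) and landed verbatim by the lead.

WHY v4.  Wave 2 closed S9 (`stub_noNeckRigidity`, p151077, unconditional) and reduced S5/S6 (`FiveArmUpperT/Z2`) to three
Literature named facts now in the tree (`Nolin2008_thm24_fiveArm_upper`, `Nolin2008_prop17_quasiMult`,
`DuminilCopinManolescuTassion2021_zdFiveArm_upperBound`; conditional proofs `fiveArmUpperT_of_nolin2008_facts` p151657,
`fiveArmUpperZ2_of_DCMT2021` p151216); the v3 transfer `stub_neckTomography` was found TRUE but MIS-CUT: its identification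
step consumes, on each lattice, the COARSE MEASURABILITY of the hook-up probability of a ball given its exterior
(`NeckHookupCoarseT` / `NeckHookupCoarseZ2` below, size L each, `α₄ > 1`-based), which v4 cuts out as stubs S11/S12.
This module carries, sorry-free: §1 `condProbOff` (conditional probability given the configuration off a coordinate set, by
the product formula) with its elementary API; §2 the coarse blob datum of an annulus (`blobOf`, `cellOf`, `coarseBlobs`);
§3 site-`𝕋` objects `tHookProb`, `tCoarse` and the stub statement `NeckHookupCoarseT`; §4 bond-`ℤ²` objects `ZFourStrands`,
`ZHookR`, `zHookProb`, `zCoarse` and the stub statement `NeckHookupCoarseZ2`; §5 the v4 transfer statement `NeckTomographyV4`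
with the pure-logic glue `neckTomographyV4_of_v3`, `neckTomographyV4_of_target` and the registered composition
`nestingRigidity_of_stubs_v4` (anchor on the crux item).  Nothing here is asserted: every `def … : Prop` is a statement to be
proved by a registered stub.  Design decisions (product formula rather than `condExp`; statements IN PROBABILITY; WHY the
coarse datum must carry blob PARTITION information and not only coarse traces; the scale window `s³ℓ ≤ lam⁴`, `L·lam ≤ s`)
are justified at each declaration and in `S10-typing.md` §1–§2.
-/

noncomputable section

namespace Summit.CriticalPhenomena.CardyFormulaZ2.Cruxes.NestingRigidity.PinchResampling

open Summit.CriticalPhenomena.CardyFormulaZ2.Theses.CardyMagicRigidity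
open MeasureTheory Set Literature.Probability.Percolation Literature.Probability.LatticeModels
  Literature.Probability.RandomPlanarGeometry

/-! ## §1 Conditional probability given the configuration off a coordinate set (product formula) -/

section CondProb

variable {ι : Type*}

/-- **`P[E | configuration off K](ω)` by the product formula.**  For a (product) measure `μ` on configurations
`Set ι`, a set of "interior" coordinates `K`, an event `E` and a configuration `ω`: the `μ`-probability that the SPLICE
`(ξ ∩ K) ∪ (ω \ K)` — a fresh sample `ξ` on `K`, the given `ω` off `K` — lies in `E`.  For `μ = sitePercolation V p`
(coordinates independent) this is a version of the conditional probability of `E` given the exterior σ-algebra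
`σ(ω ↦ ω \ K)`, defined at EVERY `ω` (no null-set ambiguity, no conditioning on the null event `{ω' \ K = ω \ K}`), with
the defining property `μ (E ∩ F) = ∫_F condProbOff μ K E dμ` for `F` measurable and `DeterminedBy F Kᶜ`
(PROVED as `measureReal_inter_eq_integral_splice` /
`real_tHook_inter_eq_integral_splice` in `…NestingRigidityExteriorConditioning`, p151755: a finite sum over the cylinders of
the ring, wave-1 `measureReal_inter_inter_localCylinder`).  This is the `g_j(ζ)` of audit §1/§3 (ii.1):
conditionally on the full exterior the hook-up bit of a region is Bernoulli with this parameter, EXACTLY. -/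
def condProbOff (μ : Measure (Set ι)) (K : Set ι) (E : Set (Set ι)) (ω : Set ι) : ℝ :=
  μ.real {ξ | ξ ∩ K ∪ ω \ K ∈ E}

/-- `condProbOff` is a probability. -/
theorem condProbOff_mem_Icc (μ : Measure (Set ι)) [IsProbabilityMeasure μ] (K : Set ι) (E : Set (Set ι)) (ω : Set ι) :
    condProbOff μ K E ω ∈ Icc (0 : ℝ) 1 :=
  ⟨measureReal_nonneg, measureReal_le_one⟩

/-- **`condProbOff` is exterior-determined**: it only reads `ω` off `K`. -/
theorem condProbOff_congr (μ : Measure (Set ι)) (K : Set ι) (E : Set (Set ι)) {ω ω' : Set ι} (h : ω \ K = ω' \ K) :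
    condProbOff μ K E ω = condProbOff μ K E ω' := by
  simp only [condProbOff, h]

/-- The splice agrees with `ω` off `K` … -/
theorem splice_diff (K ξ ω : Set ι) : (ξ ∩ K ∪ ω \ K) \ K = ω \ K := by
  ext i; by_cases hi : i ∈ K <;> simp [hi]

/-- … and with `ξ` on `K`. -/
theorem splice_inter (K ξ ω : Set ι) : (ξ ∩ K ∪ ω \ K) ∩ K = ξ ∩ K := by
  ext i; by_cases hi : i ∈ K <;> simp [hi]

/-- On an event determined by `Kᶜ` the splice is as good as `ω`: membership does not depend on the fresh sample. -/
theorem splice_mem_iff_of_determinedBy {F : Set (Set ι)} {K : Set ι} (hF : DeterminedBy F Kᶜ) (ξ ω : Set ι) :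
    ξ ∩ K ∪ ω \ K ∈ F ↔ ω ∈ F :=
  (determinedBy_iff F Kᶜ).1 hF _ _ (by rw [← sdiff_eq, ← sdiff_eq, splice_diff])

/-- Hence `condProbOff` of an exterior event is its indicator (the two degenerate values of a conditional probability). -/
theorem condProbOff_of_determinedBy (μ : Measure (Set ι)) [IsProbabilityMeasure μ] {F : Set (Set ι)} {K : Set ι}
    (hF : DeterminedBy F Kᶜ) (ω : Set ι) : condProbOff μ K F ω = F.indicator 1 ω := by
  by_cases hω : ω ∈ F
  · rw [indicator_of_mem hω, condProbOff]
    simp [splice_mem_iff_of_determinedBy hF, hω]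
  · rw [indicator_of_notMem hω, condProbOff]
    simp [splice_mem_iff_of_determinedBy hF, hω]

end CondProb

/-! ## §2 The coarse boundary datum of an annulus: big blobs touching the inner layer, by coarse footprint -/

section Coarse

variable {V : Type*}

/-- The **blob** (monochromatic component WITHIN the region `A`) of the vertex `v` in the colour graph `H`: the vertices
joined to `v` by an `H`-path of vertices of `A` (`PathIn`; `PathIn H A v v ↔ v ∈ A`, so the blob of a vertex outside `A`
is empty and the blob of an isolated vertex of `A` — e.g. a closed site for the open graph — is `{v}`). -/
def blobOf (H : SimpleGraph V) (A : Set V) (v : V) : Set V := {w | PathIn H A v w}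

/-- The **`ℓ`-cell** of a lattice point `v` for the grid of mesh `ℓ` with origin `o`: coordinatewise `⌊(v - o)/ℓ⌋`
(integer floor division; for `ℓ = 0` every point has cell `0` — excluded by `1 ≤ ℓ` in the statements).  The free origin
`o` is the randomisable grid offset of audit T3. -/
def cellOf (ℓ : ℕ) (o v : Site 2) : Site 2 := fun i ↦ (v i - o i) / (ℓ : ℤ)

/-- **The coarse blob datum of the annulus `O ∖ I`** in the colour graph `H` (lattice graph `G`, norm `N`, cell mesh `ℓ`,
bigness threshold `lam`, grid origin `o`): the pair (footprints of the big CROSSING blobs, footprints of the big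
NON-crossing blobs), where a blob is `blobOf H (O \ I) v` for `v` on the inner layer, it is BIG if two of its vertices are
`N`-distance `≥ lam` apart, CROSSING if it meets the outer layer, and its FOOTPRINT is the set of `ℓ`-cells of its
vertices on the inner layer.  A finite datum (finitely many blobs, finitely many cells) valued in a fixed type.  It is a
function of the colours of the vertices of `O \ I` only (exterior-determined for the hole `I`), and — informally, to be
proved inside the transfer — blind-visible with probability `→ 1` (`S10-typing.md` §2, blind-visibility). -/
def coarseBlobs (G H : SimpleGraph (Site 2)) (I O : Set (Site 2)) (N : Site 2 → ℤ) (ℓ lam : ℕ) (o : Site 2) :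
    Set (Set (Site 2)) × Set (Set (Site 2)) :=
  ({S | ∃ v ∈ innerLayer G I O,
      (∃ w ∈ blobOf H (O \ I) v, ∃ w' ∈ blobOf H (O \ I) v, (lam : ℤ) ≤ N (w - w')) ∧
      (∃ w ∈ blobOf H (O \ I) v, w ∈ outerLayer G I O) ∧
      S = cellOf ℓ o '' (blobOf H (O \ I) v ∩ innerLayer G I O)},
   {S | ∃ v ∈ innerLayer G I O,
      (∃ w ∈ blobOf H (O \ I) v, ∃ w' ∈ blobOf H (O \ I) v, (lam : ℤ) ≤ N (w - w')) ∧
      (∀ w ∈ blobOf H (O \ I) v, w ∉ outerLayer G I O) ∧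
      S = cellOf ℓ o '' (blobOf H (O \ I) v ∩ innerLayer G I O)})

end Coarse

/-! ## §3 Site percolation on `𝕋`: the hook-up probability of a ball given its exterior, and I1-`𝕋` -/

section SiteT

/-- **`g^𝕋_{x,s}(ω) = P[THook | exterior of Λ_s(x)](ω)`**: the probability, resampling the sites of the ball `Λ_s(x)` and
keeping `ω` outside, that the open crossings of the collar `Λ_{2s}(x) ∖ Λ_s(x)` are all joined by an open path of
`Λ_{2s}(x)` (`THook x x s s` of the Defs module: the region's state "P-hooked").  On the selection event `TPinch x x s s`
(exactly two open and two closed crossing clusters of the collar) this is the parameter of the region's routing bit given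
the exterior, exactly (audit ii.1). -/
def tHookProb (x : Site 2) (s : ℕ) (ω : SiteConfig (Site 2)) : ℝ :=
  condProbOff (triSitePercolation half) (tBall x s) (THook x x s s) ω

/-- **The coarse blob datum of the collar of `Λ_s(x)` on `𝕋`** (open colour, hexagonal norm): big open blobs of
`Λ_{2s}(x) ∖ Λ_s(x)` touching the inner layer, by `ℓ`-coarse footprint and crossing flag (`coarseBlobs`). -/
def tCoarse (ℓ lam s : ℕ) (x o : Site 2) (ω : SiteConfig (Site 2)) : Set (Set (Site 2)) × Set (Set (Site 2)) :=
  coarseBlobs triGraph (tColourGraph ω true) (tBall x s) (tBall x (2 * s)) triNorm ℓ lam o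

/-- **`NeckHookupCoarseT` — I1-`𝕋`: the hook-up probability of a ball given its exterior is coarsely measurable**
(stub S11 `stub_neckHookupCoarseT`; single-lattice, critical site percolation on `𝕋`; size L; RSW + `α₄ > 1` (RSW-only Garban /
van den Berg–Nolin bound, to be filed) + half-plane three-arm, `S10-typing.md` §2).  For every `b > 0` there is a scale ratio `L` such that for all centres `x`, grid
origins `o`, cell meshes `ℓ ≥ 1`, radii `s` and bigness thresholds `lam` in the window `s³ ℓ ≤ lam⁴`, `L · lam ≤ s` (so
`ℓ ≤ lam ≤ s/L`; the lower constraint `lam ≥ s^{3/4} ℓ^{1/4}` keeps the number `O(s/lam)` of footprint ENDS times the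
boundary two-arm cost `(ℓ/lam)^{c}` of moving one end inside its cell small, `≤ (ℓ/s)^{(3c-1)/4+…}` with `c = 1` the
universal half-plane two-arm exponent — any `c > 1/3` would do; the window is nonempty as soon as `s ≥ L⁴ ℓ`, and BOTH
lattices' provers' `L` can be met at once since the window only shrinks with `L`) there is a function `G` of the coarse blob
datum with `|g^𝕋_{x,s} − G ∘ tCoarse| ≤ b` on the selection event `TPinch x x s s` except on a part of it of relative
probability `≤ b`.  Degenerate parameters: `s = 0` or `TPinch = ∅` makes both sides `0`; `L = 0` is never useful to the
prover (then `lam > 4s` is allowed and `σ` is empty); `G` may be clamped to `[0,1]` by the consumer (`g ∈ [0,1]`,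
`condProbOff_mem_Icc`); `G` depends on `(x, o, ℓ, lam, s)` (the consumer compares probabilities position by position, so
translation invariance is not needed); uniformity in `δ` is automatic (lattice units: `s = r/δ`, `lam = λ/δ`, `ℓ = ρ/δ`;
the transfer picks `λ`, then `ρ ≤ λ⁴/r³`, after `r`).  CONSUMED by identification (audit iii.2): with `Sel`, `tCoarse` and
"unambiguous" all exterior-determined, `P(σ, unamb, Hook) = E[1_{σ,unamb} g] ≈ G(σ) P(σ, unamb)` summed over `σ`. -/
def NeckHookupCoarseT : Prop :=
  ∀ b : ℝ, 0 < b → ∃ L : ℕ, ∀ (x o : Site 2) (ℓ lam s : ℕ), 1 ≤ ℓ → s ^ 3 * ℓ ≤ lam ^ 4 → L * lam ≤ s →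
    ∃ G : Set (Set (Site 2)) × Set (Set (Site 2)) → ℝ,
      (triSitePercolation half).real (TPinch x x s s ∩ {ω | b < |tHookProb x s ω - G (tCoarse ℓ lam s x o ω)|}) ≤
        b * (triSitePercolation half).real (TPinch x x s s)

end SiteT

/-! ## §4 Bond percolation on `ℤ²`: the same objects (primal hook-up; interior = edges meeting the box) and I1-`ℤ²` -/

section BondZ2

/-- **The selection event on `ℤ²`** (`FourStrands`): exactly two primal-open crossing clusters of the primal collar
`Λ_{2s}(x) ∖ Λ_s(x)` and exactly two dual-open crossing clusters of the dual collar (dual boxes of radii `s + ½`,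
`2s + ½`, `zDualBall`, whose dual edges cross primal edges with both endpoints off `Λ_s(x)`: the event is determined by
the exterior edges `zExtEdges x s`). -/
def ZFourStrands (x : Site 2) (s : ℕ) : Set (BondConfig (Site 2)) :=
  {ω | ZFourArms ω (zBall x s) (zBall x (2 * s)) (zDualBall x s) (zDualBall x (2 * s))}

/-- **The primal hook-up of the box `Λ_s(x)` on `ℤ²`**: all primal-open crossings of the collar are joined by an open
path of `Λ_{2s}(x)`. -/
def ZHookR (x : Site 2) (s : ℕ) : Set (BondConfig (Site 2)) :=
  {ω | HookedUp (zdGraph 2) (openGraph ω) (zBall x s) (zBall x (2 * s))}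

/-- **`g^{ℤ²}_{x,s}(ω) = P[ZHookR | exterior edges of Λ_s(x)](ω)`**: resample the edges meeting the box (the complement
of `zExtEdges x s`), keep the exterior edges of `ω`. -/
def zHookProb (x : Site 2) (s : ℕ) (ω : BondConfig (Site 2)) : ℝ :=
  condProbOff (bondPercolation (zdGraph 2) half) (zExtEdges x s)ᶜ (ZHookR x s) ω

/-- **The coarse blob datum of the collar of `Λ_s(x)` on `ℤ²`** (primal open graph, sup norm). -/
def zCoarse (ℓ lam s : ℕ) (x o : Site 2) (ω : BondConfig (Site 2)) : Set (Set (Site 2)) × Set (Set (Site 2)) :=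
  coarseBlobs (zdGraph 2) (openGraph ω) (zBall x s) (zBall x (2 * s)) zNorm ℓ lam o

/-- **`NeckHookupCoarseZ2` — I1-`ℤ²`** (stub S12 `stub_neckHookupCoarseZ2`; single-lattice, critical bond percolation on `ℤ²`; size L;
inputs RSW (`ZdGeneralRSW`), `α₄ > 1` (`Garban2011_fourArm_multiscale`, `FourArmGarbanHolds`), half-plane three-arm
(`Z2HalfPlane.real_threeArm_le`)): the `ℤ²` twin of `NeckHookupCoarseT`, for the primal hook-up given the exterior
EDGES of the box, selection by `ZFourStrands`. -/
def NeckHookupCoarseZ2 : Prop :=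
  ∀ b : ℝ, 0 < b → ∃ L : ℕ, ∀ (x o : Site 2) (ℓ lam s : ℕ), 1 ≤ ℓ → s ^ 3 * ℓ ≤ lam ^ 4 → L * lam ≤ s →
    ∃ G : Set (Set (Site 2)) × Set (Set (Site 2)) → ℝ,
      (bondPercolation (zdGraph 2) half).real
          (ZFourStrands x s ∩ {ω | b < |zHookProb x s ω - G (zCoarse ℓ lam s x o ω)|}) ≤
        b * (bondPercolation (zdGraph 2) half).real (ZFourStrands x s)

end BondZ2

/-! ## §5 The v4 cut (pure logic, sorry-free) -/

/-- **The v4 transfer statement** (stub S10' `stub_neckTomographyV4`): neck tomography with the two coarse-measurability inputs cut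
out as hypotheses. -/
def NeckTomographyV4 : Prop :=
  FiveArmUpperT → FiveArmUpperZ2 → NoNeckRigidity → NeckHookupCoarseT → NeckHookupCoarseZ2 →
    LoopLimitZ2Blind → LoopLimitZ2EqT

/-- The v4 transfer is implied by the v3 stub statement (it only adds hypotheses), so re-cutting loses nothing. -/
theorem neckTomographyV4_of_v3
    (h : FiveArmUpperT → FiveArmUpperZ2 → NoNeckRigidity → LoopLimitZ2Blind → LoopLimitZ2EqT) : NeckTomographyV4 :=
  fun h₅ h₆ h₉ _ _ hB ↦ h h₅ h₆ h₉ hB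

/-- The v4 transfer is implied by the target itself. -/
theorem neckTomographyV4_of_target (hX : LoopLimitZ2EqT) : NeckTomographyV4 := fun _ _ _ _ _ _ ↦ hX

/-- **Composition of the v4 skeleton (registered helper, anchor of this module on the crux item)**: S1 blind rigidity, S5/S6 five-arm upper bounds, S9 no-neck
rigidity, S11/S12 coarse measurability on `𝕋`/`ℤ²`, S10' the v4 transfer ⟹ the crux. -/
theorem nestingRigidity_of_stubs_v4 : (MagicFormulaZ2 → MagicFormulaT → LoopLimitZ2Blind) → FiveArmUpperT → FiveArmUpperZ2 → NoNeckRigidity → NeckHookupCoarseT → NeckHookupCoarseZ2 → NeckTomographyV4 → NestingRigidity :=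
  fun h₁ h₅ h₆ h₉ h₁₁ h₁₂ h₁₀ hZ hT ↦ h₁₀ h₅ h₆ h₉ h₁₁ h₁₂ (h₁ hZ hT)

end Summit.CriticalPhenomena.CardyFormulaZ2.Cruxes.NestingRigidity.PinchResampling

end
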